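import Summits.AnomalousDissipation.AnomalousDissipation.Theorems.SolenoidalFractalHomogenisationLagrangianStepCellChainTwoSemigroup
import HarnessLib

/-!
# K1L_D `LagrangianRenormalisationStepDesign` (stmt-AnomalousDissipation-27980), registered stub `stub_D1_V0thg` (v28, ruling D28-3 (3)), port-map layer L6a:
# THE TWO-SEMIGROUP DUHAMEL BOUND WITH DECAY `‖e^{−tA} − e^{−tB}‖ ≤ ‖A − B‖ · t · e^{−rt} ≤ ‖A − B‖ · min(t, 1/(e r))` for coercive `A`, `B`
# (helper; `--supports stmt-AnomalousDissipation-27980 --as helper`)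

Summits-side helper file of route `SolenoidalFractalHomogenisation` (prover seat `ad-k1l-cellLawV-w1` g9; L6 memo
`Cruxes/LagrangianRenormalisationStepDesign/Lines/onelevel-vtheta-L6-lipschitz.md` §6, file plan of record D28-11: "`…SidebandBlockLipschitz` — state it for
ℝ-linear CLMs on a real Hilbert space once, reusable by L6c AND by lead g7's `(M_θ)` Duhamel").  Everything proved, generic in a complete real inner-product
space `E`; no definitions, no named facts, no sorry.  It EXTENDS `…CellChainTwoSemigroup` (w1 g5: the Duhamel identity `exp_sub_exp_apply_eq_integral` and the
decay-free bound `norm_exp_sub_exp_apply_le : ‖e^{−tG₁}v − e^{−tG₂}v‖ ≤ ‖G₁ − G₂‖·min t (1/r₁)·‖v‖`, both REUSED BY NAME) by the DECAYING forms the frozen-frame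
own-slot Lipschitz estimate integrates over a slot (`∫₀^∞ t e^{−rt} dt = 1/r²`):
* **`norm_exp_neg_smul_sub_apply_le`**, `opNorm_exp_neg_smul_sub_le` — if `r‖v‖² ≤ ⟪A v, v⟫` and `r‖v‖² ≤ ⟪B v, v⟫` for all `v`, then for `t ≥ 0`
  `‖e^{−tA} v − e^{−tB} v‖ ≤ ‖A − B‖ · t · e^{−rt} · ‖v‖` and `‖e^{−tA} − e^{−tB}‖ ≤ ‖A − B‖ · t · e^{−rt}` (the Duhamel integrand has norm
  `≤ e^{−r(t−s)}‖A−B‖e^{−rs}‖v‖ = e^{−rt}‖A−B‖‖v‖` EXACTLY, so no rate is lost);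
* **`opNorm_exp_neg_smul_sub_le_min`** — `t e^{−rt} ≤ 1/(e·r)` (`r > 0`), hence `‖e^{−tA} − e^{−tB}‖ ≤ ‖A − B‖ · min(t, 1/(e r))` (D28-11's spelling);
* `opNorm_exp_smul_sub_le` — the DISSIPATIVE spelling (`⟪A v, v⟫ ≤ −r‖v‖²`, semigroups `e^{tA}`), which is how `…SidebandOwnSlot.norm_exp_blockGen_le` and its
  frozen-frame twin `norm_exp_blockGenθ_le` are stated.
NOT a proof of any registered stub, of the crux, or of anomalous dissipation; rung F-D1 infrastructure (L6 of the `stub_D1_V0thg` engine).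
-/

set_option linter.dupNamespace false

noncomputable section

namespace Summit.AnomalousDissipation.AnomalousDissipation.Theorems.SolenoidalFractalHomogenisation.LagrangianStep.Sideband

open Set MeasureTheory NormedSpace intervalIntegral
open scoped InnerProductSpace
open Summit.AnomalousDissipation.AnomalousDissipation.Theorems.SolenoidalFractalHomogenisation.LagrangianStep.CellChain
  (exp_sub_exp_apply_eq_integral)

section Coercive

variable {E : Type*} [NormedAddCommGroup E] [InnerProductSpace ℝ E] [CompleteSpace E]

/-- **TWO-SEMIGROUP DUHAMEL BOUND (vector form).**  If `r‖v‖² ≤ ⟪A v, v⟫` and `r‖v‖² ≤ ⟪B v, v⟫` for all `v`, then for `t ≥ 0`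
`‖e^{−tA} v − e^{−tB} v‖ ≤ ‖A − B‖ · t · e^{−rt} · ‖v‖`. [cite: Pazy1983, Ch. 3 §3.1, eq. (1.2) and Corollary 1.3 (1.12)] [cite: SandersVerhulstMurdock2007, Lemma 5.2.7 (linear case)] -/
theorem norm_exp_neg_smul_sub_apply_le (A B : E →L[ℝ] E) {r : ℝ} (hA : ∀ v, r * ‖v‖ ^ 2 ≤ ⟪A v, v⟫_ℝ)
    (hB : ∀ v, r * ‖v‖ ^ 2 ≤ ⟪B v, v⟫_ℝ) {t : ℝ} (ht : 0 ≤ t) (v : E) :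
    ‖exp (-(t • A)) v - exp (-(t • B)) v‖ ≤ ‖A - B‖ * t * Real.exp (-(r * t)) * ‖v‖ := by
  rw [exp_sub_exp_apply_eq_integral A B v ht, norm_neg]
  have hbound : ∀ s ∈ Set.uIoc (0:ℝ) t, ‖exp (-((t - s) • A)) ((A - B) (exp (-(s • B)) v))‖ ≤ Real.exp (-(r * t)) * ‖A - B‖ * ‖v‖ := by
    intro s hs
    rw [uIoc_of_le ht] at hs
    have h1 := Literature.Analysis.ODE.PeriodicAveraging.norm_exp_neg_smul_apply_le A hA ((A - B) (exp (-(s • B)) v)) (sub_nonneg.2 hs.2)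
    have h2 := Literature.Analysis.ODE.PeriodicAveraging.norm_exp_neg_smul_apply_le B hB v hs.1.le
    have h3 : ‖(A - B) (exp (-(s • B)) v)‖ ≤ ‖A - B‖ * (Real.exp (-(r * s)) * ‖v‖) :=
      ((A - B).le_opNorm _).trans (mul_le_mul_of_nonneg_left h2 (norm_nonneg _))
    have hexp : Real.exp (-(r * (t - s))) * Real.exp (-(r * s)) = Real.exp (-(r * t)) := by
      rw [← Real.exp_add]; congr 1; ring
    calc ‖exp (-((t - s) • A)) ((A - B) (exp (-(s • B)) v))‖
        ≤ Real.exp (-(r * (t - s))) * ‖(A - B) (exp (-(s • B)) v)‖ := h1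
      _ ≤ Real.exp (-(r * (t - s))) * (‖A - B‖ * (Real.exp (-(r * s)) * ‖v‖)) := mul_le_mul_of_nonneg_left h3 (Real.exp_pos _).le
      _ = Real.exp (-(r * t)) * ‖A - B‖ * ‖v‖ := by rw [← hexp]; ring
  have h := intervalIntegral.norm_integral_le_of_norm_le_const hbound
  rw [sub_zero, abs_of_nonneg ht] at h
  calc ‖∫ s in (0:ℝ)..t, exp (-((t - s) • A)) ((A - B) (exp (-(s • B)) v))‖
      ≤ Real.exp (-(r * t)) * ‖A - B‖ * ‖v‖ * t := h
    _ = ‖A - B‖ * t * Real.exp (-(r * t)) * ‖v‖ := by ring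

/-- **TWO-SEMIGROUP DUHAMEL BOUND (operator norm).**  Under the same coercivity, `‖e^{−tA} − e^{−tB}‖ ≤ ‖A − B‖ · t · e^{−rt}` for `t ≥ 0`.
[cite: Pazy1983, Ch. 3 §3.1, Corollary 1.3 (1.12)] -/
theorem opNorm_exp_neg_smul_sub_le (A B : E →L[ℝ] E) {r : ℝ} (hA : ∀ v, r * ‖v‖ ^ 2 ≤ ⟪A v, v⟫_ℝ)
    (hB : ∀ v, r * ‖v‖ ^ 2 ≤ ⟪B v, v⟫_ℝ) {t : ℝ} (ht : 0 ≤ t) :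
    ‖exp (-(t • A)) - exp (-(t • B))‖ ≤ ‖A - B‖ * t * Real.exp (-(r * t)) :=
  ContinuousLinearMap.opNorm_le_bound _ (by positivity) fun v => by
    rw [sub_apply]; exact norm_exp_neg_smul_sub_apply_le A B hA hB ht v

/-- **TWO-SEMIGROUP DUHAMEL BOUND, `min` form** (D28-11): under coercivity with `r > 0`, `‖e^{−tA} − e^{−tB}‖ ≤ ‖A − B‖ · min(t, 1/(e r))` for `t ≥ 0`.
[cite: Pazy1983, Ch. 3 §3.1, Corollary 1.3 (1.12)] -/
theorem opNorm_exp_neg_smul_sub_le_min (A B : E →L[ℝ] E) {r : ℝ} (hr : 0 < r) (hA : ∀ v, r * ‖v‖ ^ 2 ≤ ⟪A v, v⟫_ℝ)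
    (hB : ∀ v, r * ‖v‖ ^ 2 ≤ ⟪B v, v⟫_ℝ) {t : ℝ} (ht : 0 ≤ t) :
    ‖exp (-(t • A)) - exp (-(t • B))‖ ≤ ‖A - B‖ * min t (1 / (Real.exp 1 * r)) := by
  have h := opNorm_exp_neg_smul_sub_le A B hA hB ht
  have hAB : 0 ≤ ‖A - B‖ := norm_nonneg _
  -- `t e^{−rt} ≤ 1/(e r)`: from `x + 1 ≤ eˣ` at `x = rt − 1` (also `B11B3.mul_exp_neg_le` in the Bałaban corpus; not imported into this chain)
  have hte : t * Real.exp (-(r * t)) ≤ 1 / (Real.exp 1 * r) := by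
    have h1 : r * t ≤ Real.exp (r * t - 1) := by linarith [Real.add_one_le_exp (r * t - 1)]
    have hpos : 0 < Real.exp 1 * r := mul_pos (Real.exp_pos 1) hr
    rw [le_div_iff₀ hpos]
    have h2 : r * t * Real.exp (-(r * t)) ≤ Real.exp (-(1:ℝ)) := by
      have h3 := mul_le_mul_of_nonneg_right h1 (Real.exp_pos (-(r * t))).le
      rwa [← Real.exp_add, show r * t - 1 + -(r * t) = -(1:ℝ) by ring] at h3
    have h4 : Real.exp (-(1:ℝ)) * Real.exp 1 = 1 := by rw [← Real.exp_add]; simp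
    calc t * Real.exp (-(r * t)) * (Real.exp 1 * r) = r * t * Real.exp (-(r * t)) * Real.exp 1 := by ring
      _ ≤ Real.exp (-(1:ℝ)) * Real.exp 1 := mul_le_mul_of_nonneg_right h2 (Real.exp_pos 1).le
      _ = 1 := h4
  have he1 : Real.exp (-(r * t)) ≤ 1 := by rw [Real.exp_le_one_iff]; nlinarith
  rcases le_total t (1 / (Real.exp 1 * r)) with hle | hle
  · rw [min_eq_left hle]
    calc ‖exp (-(t • A)) - exp (-(t • B))‖ ≤ ‖A - B‖ * t * Real.exp (-(r * t)) := h
      _ ≤ ‖A - B‖ * t * 1 := mul_le_mul_of_nonneg_left he1 (by positivity)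
      _ = ‖A - B‖ * t := mul_one _
  · rw [min_eq_right hle]
    calc ‖exp (-(t • A)) - exp (-(t • B))‖ ≤ ‖A - B‖ * t * Real.exp (-(r * t)) := h
      _ = ‖A - B‖ * (t * Real.exp (-(r * t))) := mul_assoc _ _ _
      _ ≤ ‖A - B‖ * (1 / (Real.exp 1 * r)) := mul_le_mul_of_nonneg_left hte hAB

/-- **DISSIPATIVE SPELLING** (as `…SidebandOwnSlot.norm_exp_blockGen_le` is stated): if `⟪A v, v⟫ ≤ −r‖v‖²` and `⟪B v, v⟫ ≤ −r‖v‖²` for all `v`, then for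
`t ≥ 0`, `‖e^{tA} − e^{tB}‖ ≤ ‖A − B‖ · t · e^{−rt}`. [cite: Pazy1983, Ch. 3 §3.1, Corollary 1.3 (1.12)] -/
theorem opNorm_exp_smul_sub_le (A B : E →L[ℝ] E) {r : ℝ} (hA : ∀ v, ⟪A v, v⟫_ℝ ≤ -r * ‖v‖ ^ 2)
    (hB : ∀ v, ⟪B v, v⟫_ℝ ≤ -r * ‖v‖ ^ 2) {t : ℝ} (ht : 0 ≤ t) :
    ‖exp (t • A) - exp (t • B)‖ ≤ ‖A - B‖ * t * Real.exp (-(r * t)) := by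
  have hA' : ∀ v, r * ‖v‖ ^ 2 ≤ ⟪(-A) v, v⟫_ℝ := fun v => by
    rw [neg_apply, inner_neg_left]; linarith [hA v]
  have hB' : ∀ v, r * ‖v‖ ^ 2 ≤ ⟪(-B) v, v⟫_ℝ := fun v => by
    rw [neg_apply, inner_neg_left]; linarith [hB v]
  have h := opNorm_exp_neg_smul_sub_le (-A) (-B) hA' hB' ht
  rw [smul_neg, smul_neg, neg_neg, neg_neg, neg_sub_neg, norm_sub_rev B A] at h
  exact h

end Coercive

end Summit.AnomalousDissipation.AnomalousDissipation.Theorems.SolenoidalFractalHomogenisation.LagrangianStep.Sideband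

end
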